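import Literature.NumberTheory.GaloisRepresentations.ModNCyclotomicCharacter
import Literature.NumberTheory.Automorphic.LanglandsTunnellLSeriesProofs
import Literature.NumberTheory.EllipticCurves.HeckeOperatorsDiamondProofs
import Literature.NumberTheory.GaloisRepresentations.ArtinRepFrobenius
import Literature.NumberTheory.Automorphic.DeligneSerreThm46Proofs
import HarnessLib

/-!
# Deligne–Serre 1974, Rem. 4.4–4.5: oddness of the representation attached to a weight-one
newform, from Lemma 3.2 (proofs)

This file **proves** the named fact `Literature.NumberTheory.EllipticCurves.ModularForms.DeligneSerre1974.rem45_isOdd`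
(`Literature.NumberTheory.EllipticCurves.NewformGaloisRepProofs`: a finite-image representation
`ρ : Γ_ℚ → GL₂(ℂ)` attached away from `N` to a weight-one newform `f ∈ S_1(Γ₁(N))` is odd)
from the named fact `Literature.NumberTheory.GaloisRepresentations.DeligneSerre1974.lemma32_complex`
(`Literature.NumberTheory.GaloisRepresentations.ArtinRepFrobenius`: Deligne–Serre's Lemma 3.2,
"a semisimple complex representation is determined by its Frobenius polynomials", Chebotarev),
following Deligne–Serre, *Formes modulaires de poids 1*, Ann. Sci. ÉNS (4) 7 (1974), Rem. 4.4
and Rem. 4.5 (p. 515) literally: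

* Rem. 4.4: "La formule `det(F_p) = ε(p)` montre que l'on a `det(ρ) = ε`, en convenant
  d'identifier `ε` au caractère `G → ℂ^*` qui lui correspond par la théorie du corps de classes
  (c'est simplement le composé de `ε` et de l'homomorphisme `G → (ℤ/Nℤ)^*` fourni par
  l'action de `G` sur les racines `N`-ièmes de l'unité)."  Here `G → (ℤ/Nℤ)^*` is
  `Literature.NumberTheory.GaloisRepresentations.modNCyclotomicCharacter` (Mathlib's `modularCyclotomicCharacter` on `K̄`), the composite
  is `Literature.dirichletGaloisCharacter ε : Γ_K →ₜ* ℂˣ` (continuity proved: locally constant), and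
  "montre" is Lemma 3.2 applied to the two rank-one representations `det ∘ ρ` and `ε ∘ χ_N`
  (`FramedRep.ofCharacter`): both have finite image, are unramified at `p ∤ N`, and have the
  Frobenius polynomial `X - ε(p)` there — for `det ∘ ρ` because
  `charpoly ρ(Frob_p) = X² - a_p X + ε(p)` (`IsGaloisRepOfNewform1`, `det_eq_of_charpoly_eq`),
  for `ε ∘ χ_N` because `χ_N(Frob_𝔓) = p` and `χ_N(I_𝔓) = 1` for `𝔓 ∤ N`
  (`modNCyclotomicCharacter_eq_residueCard_of_isArithFrobAt`,
  `modNCyclotomicCharacter_eq_one_of_mem_inertia`: the `N`-th roots of unity are distinct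
  modulo `𝔓`, `IsPrimitiveRoot.pow_eq_pow_of_sub_mem`, from Mathlib's
  `IsPrimitiveRoot.prod_one_sub_pow_eq_order`, `∏ (1 - ζ^k) = N`).  Equivalent rank-one
  representations are equal (`FramedRep.eq_of_equiv_of_rank_one`), so `det ∘ ρ = ε ∘ χ_N`.
* Rem. 4.5: "Notons `c` l'élément de `G` correspondant à la conjugaison complexe …  Du fait que
  `ε` est impair, 4.4 montre que `det(ρ(c)) = -1`": `χ_N(c) = -1`
  (`modNCyclotomicCharacter_of_isComplexConjugation`: `conj ζ = ζ⁻¹` on the unit circle) and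
  `ε(-1) = -1` (`IsNewform1.nebentypus_neg_one`: `⟨-1⟩` acts on `S_k(Γ₁(N))` by `(-1)^k`,
  `diamondOp_neg_one_apply`, and by `ε(-1)` on a newform; Diamond–Shurman §4.3).

Main results: `ModularForms.DeligneSerre1974.rem45_isOdd_of : lemma32_complex → rem45_isOdd`;
`ModularForms.IsNewform1.nebentypus_neg_one` (`ε(-1) = (-1)^k` for a newform of weight `k`);
`ModularForms.diamondOp_neg_one_apply` (`⟨-1⟩ = (-1)^k`); and the corollaries
`ModularForms.DeligneSerre1974.thm46a_of_lemma32`, `Lang.artinConductorNat_eq_level_of_lemma32`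
(Thm. 4.6 (a), `Literature.NumberTheory.Automorphic.DeligneSerreThm46Proofs`, with Rem. 4.5
replaced by Lemma 3.2 among its inputs).  The Galois-side inputs (the mod `N`
cyclotomic character `χ_N`, `dirichletGaloisCharacter`, its values on inertia, Frobenius and
complex conjugation, rank-one framed representations) live in
`Literature.NumberTheory.GaloisRepresentations.ModNCyclotomicCharacter`.  No new named facts.

## References

* P. Deligne, J.-P. Serre, *Formes modulaires de poids 1*, Ann. Sci. ÉNS (4) 7 (1974),
  507–530, Rem. 4.4, Rem. 4.5 (p. 515), Lemme 3.2 (p. 513) (`DeligneSerreASENS1974`).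
* F. Diamond, J. Shurman, *A First Course in Modular Forms*, GTM 228 (2005), §4.3 p. 119
  (`M_k(N, χ) = 0` unless `χ(-1) = (-1)^k`), §5.2 pp. 168–169 (diamond operators)
  (`DiamondShurman2005`).
* J. Neukirch, *Algebraic Number Theory* (1999), Ch. I §10, (10.3) (decomposition of `p ∤ N`
  in `ℚ(ζ_N)`, Frobenius `ζ ↦ ζ^p`) (`NeukirchANT1999`).
-/

noncomputable section

open scoped NumberField MatrixGroups ModularForm
open Field IsDedekindDomain NumberField Polynomial UpperHalfPlane CongruenceSubgroup
  Matrix.SpecialLinearGroup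

namespace Literature.NumberTheory.EllipticCurves

/-! ### The nebentypus of a newform is odd in odd weight -/

namespace ModularForms

variable {N : ℕ} [NeZero N] {k : ℤ}

/-- Slashing by `-1 ∈ SL(2, ℤ)` in weight `k` multiplies a function on `ℍ` by `(-1)^k`
(`-1` acts trivially on `ℍ` and `j(-1, τ) = -1`; Diamond–Shurman §4.3, p. 119).
[cite: DiamondShurman2005, §4.3 p. 119] -/
theorem slash_neg_one_SL (f : ℍ → ℂ) (k : ℤ) :
    f ∣[k] (-1 : SL(2, ℤ)) = ((-1 : ℂ) ^ k) • f := by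
  ext τ
  rw [ModularForm.SL_slash_apply, ModularGroup.SL_neg_smul, one_smul, Pi.smul_apply, smul_eq_mul]
  have hd : denom ((-1 : SL(2, ℤ)) : GL (Fin 2) ℝ) τ = -1 := by
    simp [denom, toGL]
  rw [hd, mul_comm]
  congr 1
  rw [zpow_neg, ← inv_zpow, inv_neg, inv_one]

omit [NeZero N] in
/-- `Γ₀(N)` is stable under `γ ↦ -γ`. [folklore] -/
theorem neg_mem_gamma0 {γ : SL(2, ℤ)} (h : γ ∈ Gamma0 N) : -γ ∈ Gamma0 N := by
  rw [Gamma0_mem] at h ⊢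
  rw [Matrix.SpecialLinearGroup.coe_neg, Matrix.neg_apply, Int.cast_neg, h, neg_zero]

omit [NeZero N] in
/-- The reduction map `Γ₀(N) → ℤ/Nℤ`, `γ ↦ d`, is odd: `(-γ) ↦ -d`. [folklore] -/
theorem gamma0Map_neg (γ : Gamma0 N) :
    Gamma0Map N ⟨-(γ : SL(2, ℤ)), neg_mem_gamma0 γ.2⟩ = -Gamma0Map N γ := by
  show (((((-(γ : SL(2, ℤ))) : SL(2, ℤ)) : Matrix (Fin 2) (Fin 2) ℤ) 1 1 : ℤ) : ZMod N) =
    -((((γ : SL(2, ℤ)) : Matrix (Fin 2) (Fin 2) ℤ) 1 1 : ℤ) : ZMod N)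
  rw [Matrix.SpecialLinearGroup.coe_neg, Matrix.neg_apply, Int.cast_neg]

/-- **The diamond operator `⟨-1⟩` acts on `S_k(Γ₁(N))` by `(-1)^k`**: the chosen lift
`γ ∈ Γ₀(N)` of `-1` is `(-1) · γ'` with `γ' ∈ Γ₁(N)`, and `f ∣[k] (-1) = (-1)^k f`
(`slash_neg_one_SL`), `f ∣[k] γ' = f` (Diamond–Shurman §4.3, p. 119 and §5.2, p. 168:
`Γ₁(N)` acts trivially; `coe_cuspHeckeOperatorₗ_gamma1` of `HeckeOperatorsDiamondProofs`).
[cite: DiamondShurman2005, §4.3 p. 119] -/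
theorem diamondOp_neg_one_apply (f : CuspForm (Gamma1 N) k) :
    diamondOp N k (-1) f = ((-1 : ℂ) ^ k) • f := by
  unfold diamondOp
  have hex : ∃ γ : Gamma0 N, Gamma0Map N γ = -1 :=
    ⟨⟨-1, neg_mem_gamma0 (Subgroup.one_mem _)⟩, by
      rw [show (⟨-1, _⟩ : Gamma0 N) = ⟨-((1 : Gamma0 N) : SL(2, ℤ)), neg_mem_gamma0 (1 : Gamma0 N).2⟩
        from rfl, gamma0Map_neg, map_one]⟩
  rw [dif_pos hex]
  apply DFunLike.coe_injective
  rw [coe_cuspHeckeOperatorₗ_gamma1]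
  have hγ1 : Gamma0Map N hex.choose = -1 := hex.choose_spec
  have hneg1 : -(hex.choose : SL(2, ℤ)) ∈ Gamma1 N := by
    refine mem_gamma1_of_gamma0Map_eq_one N (γ := ⟨-(hex.choose : SL(2, ℤ)),
      neg_mem_gamma0 hex.choose.2⟩) ?_
    rw [gamma0Map_neg, hγ1, neg_neg]
  calc ⇑f ∣[k] mapGL ℝ (hex.choose : SL(2, ℤ)) = ⇑f ∣[k] (hex.choose : SL(2, ℤ)) := rfl
    _ = ⇑f ∣[k] ((-1 : SL(2, ℤ)) * -(hex.choose : SL(2, ℤ))) := by rw [neg_mul_neg, one_mul]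
    _ = (((-1 : ℂ) ^ k) • ⇑f) ∣[k] (-(hex.choose : SL(2, ℤ))) := by
      rw [SlashAction.slash_mul, slash_neg_one_SL]
    _ = ((-1 : ℂ) ^ k) • (⇑f ∣[k] (-(hex.choose : SL(2, ℤ)))) := ModularForm.SL_smul_slash _ _ _ _
    _ = ((-1 : ℂ) ^ k) • ⇑f := by
      congr 1
      exact SlashInvariantFormClass.slash_action_eq f _ (Subgroup.mem_map_of_mem (mapGL ℝ) hneg1)
    _ = ⇑(((-1 : ℂ) ^ k) • f) := rfl

/-- **The nebentypus of a newform of weight `k` on `Γ₁(N)` has parity `ε(-1) = (-1)^k`**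
(`⟨-1⟩ f = ε(-1) f` by `IsNewform1.diamondOp_apply_eq_nebentypus_smul`, `= (-1)^k f` by
`diamondOp_neg_one_apply`, and `f ≠ 0`).  In particular `ε` is odd in weight one
("`ε` est impair", Deligne–Serre 1974, Rem. 4.5; hypothesis `ε(-1) = -1` of their Thm. 4.1;
Diamond–Shurman §4.3, p. 119: `M_k(N, χ) = 0` unless `χ(-1) = (-1)^k`).
[cite: DiamondShurman2005, §4.3 p. 119] -/
theorem IsNewform1.nebentypus_neg_one {f : CuspForm (Gamma1 N) k} (hf : IsNewform1 f) :
    nebentypus f (-1) = (-1) ^ k := by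
  have h := hf.diamondOp_apply_eq_nebentypus_smul (-1)
  rw [Units.val_neg, Units.val_one, diamondOp_neg_one_apply] at h
  by_contra hne
  have h' : ((-1 : ℂ) ^ k - nebentypus f (-1)) • f = 0 := by rw [sub_smul, h, sub_self]
  exact hf.ne_zero ((smul_eq_zero.mp h').resolve_left (sub_ne_zero.mpr (Ne.symm hne)))

end ModularForms

/-! ### Deligne–Serre 1974, Rem. 4.4–4.5: `det ρ = ε`, hence `ρ` is odd -/

namespace ModularForms.DeligneSerre1974

open Rat.HeightOneSpectrum

variable {N : ℕ} [NeZero N]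

/-- The determinant of a `2 × 2` matrix with characteristic polynomial `X² - a X + b` is `b`
(Mathlib `Matrix.det_eq_sign_charpoly_coeff`). [folklore] -/
theorem det_eq_of_charpoly_eq {M : Matrix (Fin 2) (Fin 2) ℂ} {a b : ℂ}
    (h : M.charpoly = X ^ 2 - C a * X + C b) : M.det = b := by
  rw [Matrix.det_eq_sign_charpoly_coeff, h]
  simp

/-- **Deligne–Serre 1974, Rem. 4.4–4.5 from Lemma 3.2.**  Let `f ∈ S_1(Γ₁(N))` be a newform
with nebentypus `ε` and `ρ : Γ_ℚ → GL₂(ℂ)` a representation with finite image attached to `f`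
away from `N`.  Rem. 4.4: "La formule `det(F_p) = ε(p)` montre que l'on a `det(ρ) = ε`, en
convenant d'identifier `ε` au caractère `G → ℂ^*` qui lui correspond par la théorie du corps
de classes (c'est simplement le composé de `ε` et de l'homomorphisme `G → (ℤ/Nℤ)^*` fourni
par l'action de `G` sur les racines `N`-ièmes de l'unité)" — here: the rank-one
representations `det ∘ ρ` and `ε ∘ χ_N` (`dirichletGaloisCharacter`) have finite image, are
unramified at `p ∤ N` (`modNCyclotomicCharacter_eq_one_of_mem_inertia`) with the same
Frobenius polynomial `X - ε(p)` (`det_eq_of_charpoly_eq`,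
`modNCyclotomicCharacter_eq_residueCard_of_isArithFrobAt`), so they are isomorphic by
Lemma 3.2 (the named fact `Literature.NumberTheory.GaloisRepresentations.DeligneSerre1974.lemma32_complex`, Chebotarev), hence equal
(`FramedRep.eq_of_equiv_of_rank_one`).  Rem. 4.5: "Du fait que `ε` est impair, 4.4 montre que
`det(ρ(c)) = -1`": `χ_N(c) = -1` (`modNCyclotomicCharacter_of_isComplexConjugation`) and
`ε(-1) = -1` in weight one (`IsNewform1.nebentypus_neg_one`).  This discharges the named fact
`rem45_isOdd` (`Literature.NumberTheory.EllipticCurves.NewformGaloisRepProofs`) modulo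
Lemma 3.2. [cite: DeligneSerreASENS1974, Rem. 4.4 and Rem. 4.5] -/
theorem rem45_isOdd_of (h32 : Literature.NumberTheory.GaloisRepresentations.DeligneSerre1974.lemma32_complex) : rem45_isOdd (N := N) := by
  intro f hf ρ hρ hfin
  haveI : NeZero (N : ℚ) := NeZero.charZero
  set ε : DirichletCharacter ℂ N := nebentypus f with hε
  set χ₁ : GaloisRepresentations.FramedGaloisRep ℚ ℂ 1 := GaloisRepresentations.FramedRep.ofCharacter (GaloisRepresentations.FramedRep.det ρ) with hχ₁
  set χ₂ : GaloisRepresentations.FramedGaloisRep ℚ ℂ 1 :=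
    GaloisRepresentations.FramedRep.ofCharacter (GaloisRepresentations.dirichletGaloisCharacter ℚ ε) with hχ₂
  -- finite images
  have hfin₁ : (Set.range χ₁).Finite := by
    refine GaloisRepresentations.FramedRep.finite_range_ofCharacter ?_
    have : Set.range (GaloisRepresentations.FramedRep.det ρ) =
        (Matrix.GeneralLinearGroup.det : GL (Fin 2) ℂ →* ℂˣ) '' Set.range ρ := by
      rw [← Set.range_comp]; rfl
    rw [this]
    exact hfin.image _
  have hfin₂ : (Set.range χ₂).Finite :=
    GaloisRepresentations.FramedRep.finite_range_ofCharacter (GaloisRepresentations.finite_range_dirichletGaloisCharacter ℚ ε)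
  -- Lemma 3.2 away from the primes dividing `N`
  have hequiv := h32 N.primeFactors χ₁ χ₂ hfin₁ hfin₂ (GaloisRepresentations.FramedRep.isSemisimple_of_rank_one χ₁)
    (GaloisRepresentations.FramedRep.isSemisimple_of_rank_one χ₂) (fun v hv => ?_)
  · -- Rem. 4.5
    obtain ⟨e⟩ := hequiv
    have heq : GaloisRepresentations.FramedRep.det ρ = GaloisRepresentations.dirichletGaloisCharacter ℚ ε :=
      GaloisRepresentations.FramedRep.ofCharacter_injective (GaloisRepresentations.FramedRep.eq_of_equiv_of_rank_one χ₁ χ₂ e)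
    rw [GaloisRepresentations.FramedGaloisRep.isOdd_iff]
    intro φ c hc
    rw [heq]
    apply Units.ext
    rw [GaloisRepresentations.coe_dirichletGaloisCharacter_apply, GaloisRepresentations.modNCyclotomicCharacter_of_isComplexConjugation hc,
      Units.val_neg, Units.val_one, hε, hf.nebentypus_neg_one, zpow_one]
  · -- Rem. 4.4: the local conditions at `p ∤ N`
    have hpN : ¬ ((primesEquiv v : Nat.Primes) : ℕ) ∣ N := fun h =>
      hv (Nat.mem_primeFactors.mpr ⟨(primesEquiv v).2, h, NeZero.ne N⟩)
    obtain ⟨hur, hchar⟩ := hρ v hpN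
    refine ⟨?_, ?_, X - C (ε ((primesEquiv v : Nat.Primes) : ZMod N)), ?_, ?_⟩
    · intro 𝔓 h𝔓 σ hσ
      have h1 : ρ σ = 1 := hur 𝔓 h𝔓 σ hσ
      apply Units.ext
      ext i j
      rw [Subsingleton.elim i j, hχ₁, GaloisRepresentations.FramedRep.ofCharacter_apply_coe, GaloisRepresentations.FramedRep.det_apply, h1,
        map_one, Units.val_one, Units.val_one, Matrix.one_apply_eq]
    · intro 𝔓 h𝔓 σ hσ
      haveI : 𝔓.IsPrime := h𝔓.1
      have h1 := GaloisRepresentations.modNCyclotomicCharacter_eq_one_of_mem_inertia (K := ℚ) (N := N)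
        (GaloisRepresentations.Rat.natCast_not_mem_of_mem_primesAbove_of_not_dvd h𝔓 hpN) hσ
      apply Units.ext
      ext i j
      rw [Subsingleton.elim i j, hχ₂, GaloisRepresentations.FramedRep.ofCharacter_apply_coe,
        GaloisRepresentations.coe_dirichletGaloisCharacter_apply, h1, Units.val_one, map_one, Units.val_one,
        Matrix.one_apply_eq]
    · intro 𝔓 h𝔓 σ hσ
      have h1 := hchar 𝔓 h𝔓 σ hσ
      rw [Automorphic.map_heckePolynomial_weight_one] at h1
      rw [hχ₁, GaloisRepresentations.FramedRep.charpoly_ofCharacter, GaloisRepresentations.FramedRep.det_apply,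
        Matrix.GeneralLinearGroup.val_det_apply, det_eq_of_charpoly_eq h1]
    · intro 𝔓 h𝔓 σ hσ
      haveI : 𝔓.IsPrime := h𝔓.1
      have h1 := GaloisRepresentations.modNCyclotomicCharacter_eq_residueCard_of_isArithFrobAt (K := ℚ) (N := N) h𝔓
        (GaloisRepresentations.Rat.natCast_not_mem_of_mem_primesAbove_of_not_dvd h𝔓 hpN) hσ
      rw [hχ₂, GaloisRepresentations.FramedRep.charpoly_ofCharacter, GaloisRepresentations.coe_dirichletGaloisCharacter_apply, h1,
        GaloisRepresentations.Rat.residueCard_eq_natGenerator]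
      rfl

/-- **Deligne–Serre 1974, Thm. 4.6 (a) from Lemma 3.2, (i), 1.8 and Artin's functional
equation**: `thm46a_of` (`Literature.NumberTheory.Automorphic.DeligneSerreThm46Proofs`) with
its oddness input Rem. 4.5 discharged by `rem45_isOdd_of`.
[cite: DeligneSerreASENS1974, Thm. 4.6 (a)] -/
theorem thm46a_of_lemma32 (h32 : Literature.NumberTheory.GaloisRepresentations.DeligneSerre1974.lemma32_complex)
    (hFE : weightOne_functionalEquation (N := N))
    (h18 : IsNewform1.cuspCoeff_of_dvd_level (N := N) (k := 1))
    (hAFE : Automorphic.artin_functional_equation (K := ℚ)) :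
    Automorphic.ModularForms.DeligneSerre1974.thm46a_artinConductorNat_eq (N := N) :=
  Automorphic.ModularForms.DeligneSerre1974.thm46a_of (rem45_isOdd_of h32) hFE h18 hAFE

end ModularForms.DeligneSerre1974

section Lang

open ModularForms ModularForms.DeligneSerre1974 Automorphic.ModularForms.DeligneSerre1974

variable {N : ℕ} [NeZero N] {f : CuspForm (Gamma1 N) 1} {ρ : GaloisRepresentations.FramedArtinRep ℚ 2}

/-- **The named fact `artinConductorNat_eq_level` from four standard named facts**: Lemma 3.2
(`Literature.NumberTheory.GaloisRepresentations.DeligneSerre1974.lemma32_complex`, Chebotarev), the weight-one functional equation (i)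
(`weightOne_functionalEquation`), 1.8 (`IsNewform1.cuspCoeff_of_dvd_level`, `k = 1`) and
Artin's functional equation (`artin_functional_equation` over `ℚ`); everything specific to
Deligne–Serre's proof of Thm. 4.6 (a) — steps (iii)–(iv), Lemma 4.9, the Euler products,
the conductor of the dual, Rem. 4.4–4.5 — is proved.  When these four are discharged,
`theorem artinConductorNat_eq_level_holds` is this theorem applied to their `_holds` versions.
[cite: DeligneSerreASENS1974, Thm. 4.6 (a) and Rem. 4.3] -/
theorem artinConductorNat_eq_level_of_lemma32 (h32 : Literature.NumberTheory.GaloisRepresentations.DeligneSerre1974.lemma32_complex)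
    (hFE : weightOne_functionalEquation (N := N))
    (h18 : IsNewform1.cuspCoeff_of_dvd_level (N := N) (k := 1))
    (hAFE : Automorphic.artin_functional_equation (K := ℚ)) :
    Automorphic.artinConductorNat_eq_level (f := f) (ρ := ρ) :=
  Automorphic.artinConductorNat_eq_level_of' (rem45_isOdd_of h32) hFE h18 hAFE

end Lang

end Literature.NumberTheory.EllipticCurves
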